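import Literature.Computability.Complexity.CNF
import Literature.Computability.MetaComplexity.PolynomialCalculus
import HarnessLib

/-!
# Polynomial calculus: the standard translation of clauses and CNFs into polynomials (any field)

Companion of `PolynomialCalculus.lean` (Krajíček's PC/F, `PC.DerivableInDegree`, `PC.RefutableInDegree`),
whose module docstring lists "the translation of CNFs into polynomial systems ((6.0.1) of the book)"
as not yet present.  This file supplies it, over an arbitrary field `K` and for the tree's CNFs
(`CNF ℕ = List (Clause ℕ)`, a literal `(v, b)` being true iff `x_v = b`):

* `PC.ofLiteral K l` — the polynomial that is `1` exactly where the literal `l` is FALSE: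
  `(v, true) ↦ 1 - x_v`, `(v, false) ↦ x_v`;
* `PC.ofClause K C = ∏_{l ∈ C} PC.ofLiteral K l` — Krajíček's `f_C` ((6.0.1)): on Boolean points it
  is `0` iff `C` is satisfied (`PC.eval_ofClause`), and `deg (PC.ofClause K C) = |C|`
  (`PC.totalDegree_ofClause`);
* `PC.ofCNF K φ = {PC.ofClause K C : C ∈ φ}` — the axiom set refuted by a PC refutation "of `φ`".

The same translation already exists twice in special positions — over `ℝ` as
`Literature.Computability.MetaComplexity.litFalsePoly` / `unsatPoly` (`SumOfSquares.lean`) and over a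
field `K` as `Summit.PneNP.PneNP.Theorems.PolyCalc.litFalsePolyK` / `unsatPolyK` / `cnfPolys`
(Summits side, route ExpanderLinearGenerators, whose TODO invites this move); the definitions here
are the same terms, so the Summits bridge is `rfl` (`Summits/…/ReslinSizeFromWidthPCDegreeGOP.lean`).
Literature statements about PC degree of CNF families (e.g. Galesi–Lauria 2010 for graph ordering
principles, `GraphOrderingPrincipleDegree.lean`) are phrased with `PC.ofCNF`.

References: J. Krajíček, *Proof Complexity*, CUP 2019, §6 (6.0.1) and §6.2
[KrajicekProofComplexity2019]; M. Clegg, J. Edmonds, R. Impagliazzo, STOC 1996, §2.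
-/

noncomputable section

namespace Literature.Computability.MetaComplexity.PC

open MvPolynomial Literature.Computability.Complexity

variable (K : Type*) [Field K]

/-- The falsity polynomial of a literal: `(v, true) ↦ 1 - x_v`, `(v, false) ↦ x_v` (equal to `1`
at a Boolean point iff the literal is false there). [Krajíček 2019, §6 (6.0.1)]
[cite: KrajicekProofComplexity2019, §6 (6.0.1)] -/
def ofLiteral (l : Literal ℕ) : MvPolynomial ℕ K :=
  if l.2 then 1 - X l.1 else X l.1

/-- Krajíček's translation `f_C` of a clause: the product of the falsity polynomials of its
literals (equal to `1` at a Boolean point iff the clause is falsified there, else `0`).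
[Krajíček 2019, §6 (6.0.1)] [cite: KrajicekProofComplexity2019, §6 (6.0.1)] -/
def ofClause (C : Clause ℕ) : MvPolynomial ℕ K :=
  (C.map (ofLiteral K)).prod

/-- The polynomial system of a CNF: `{f_C : C ∈ φ}` (the Boolean axioms `x² - x` belong to the
calculus `PC.DerivableInDegree`).  A "PC refutation of `φ` of degree `≤ d`" is
`PC.RefutableInDegree (PC.ofCNF K φ) d`. [Krajíček 2019, §6 (6.0.1), §6.2]
[cite: KrajicekProofComplexity2019, §6 (6.0.1)] -/
def ofCNF (φ : CNF ℕ) : Set (MvPolynomial ℕ K) :=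
  {p | ∃ C ∈ φ, p = ofClause K C}

variable {K}

/-- Membership in the translated system. [folklore] -/
theorem mem_ofCNF {φ : CNF ℕ} {p : MvPolynomial ℕ K} :
    p ∈ ofCNF K φ ↔ ∃ C ∈ φ, p = ofClause K C := Iff.rfl

/-- The translation of a clause of `φ` belongs to the system. [folklore] -/
theorem ofClause_mem_ofCNF {φ : CNF ℕ} {C : Clause ℕ} (hC : C ∈ φ) : ofClause K C ∈ ofCNF K φ :=
  ⟨C, hC, rfl⟩

/-- Unfolding on `nil`. [folklore] -/
@[simp] theorem ofClause_nil : ofClause K ([] : Clause ℕ) = 1 := by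
  simp [ofClause]

/-- Unfolding on `cons`. [folklore] -/
theorem ofClause_cons (l : Literal ℕ) (C : Clause ℕ) :
    ofClause K (l :: C) = ofLiteral K l * ofClause K C := by
  rw [ofClause, List.map_cons, List.prod_cons]; rfl

/-- The falsity polynomial of a literal has degree one. [folklore] -/
theorem totalDegree_ofLiteral (l : Literal ℕ) : (ofLiteral K l).totalDegree = 1 := by
  unfold ofLiteral
  split
  · rw [show (1 : MvPolynomial ℕ K) - X l.1 = -X l.1 + 1 by ring,
      totalDegree_add_eq_left_of_totalDegree_lt, totalDegree_neg, totalDegree_X]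
    rw [totalDegree_neg, totalDegree_X, totalDegree_one]
    exact zero_lt_one
  · exact totalDegree_X _

/-- Hence it is nonzero. [folklore] -/
theorem ofLiteral_ne_zero (l : Literal ℕ) : ofLiteral K l ≠ 0 := by
  intro h
  have := totalDegree_ofLiteral (K := K) l
  rw [h, totalDegree_zero] at this
  exact zero_ne_one this

/-- `f_C ≠ 0`. [folklore] -/
theorem ofClause_ne_zero (C : Clause ℕ) : ofClause K C ≠ 0 := by
  induction C with
  | nil => simp
  | cons l C ih => rw [ofClause_cons]; exact mul_ne_zero (ofLiteral_ne_zero l) ih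

/-- **Degree of a clause polynomial**: `deg f_C = |C|` (literals counted with repetition).
[Krajíček 2019, §6] [folklore] -/
theorem totalDegree_ofClause (C : Clause ℕ) : (ofClause K C).totalDegree = C.length := by
  induction C with
  | nil => simp
  | cons l C ih =>
    rw [ofClause_cons, totalDegree_mul_of_isDomain (ofLiteral_ne_zero l) (ofClause_ne_zero C),
      totalDegree_ofLiteral, ih, List.length_cons, add_comm]

/-- **Semantics of the translation**: at a Boolean point, `f_C` evaluates to `0` if the clause is
satisfied and to `1` otherwise. [Krajíček 2019, §6 (6.0.1)] [folklore] -/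
theorem eval_ofClause (σ : ℕ → Bool) (C : Clause ℕ) :
    MvPolynomial.eval (fun v => if σ v then (1 : K) else 0) (ofClause K C) =
      if C.eval σ then 0 else 1 := by
  induction C with
  | nil => simp [Clause.eval]
  | cons l C ih =>
    have hl : MvPolynomial.eval (fun v => if σ v then (1 : K) else 0) (ofLiteral K l) =
        if l.eval σ then 0 else 1 := by
      rcases l with ⟨v, b⟩
      cases b <;> cases hσ : σ v <;> simp [ofLiteral, Literal.eval, hσ]
    rw [ofClause_cons, map_mul, ih, hl]
    simp only [Clause.eval, List.any_cons]
    by_cases h1 : Literal.eval σ l = true <;> by_cases h2 : C.any (Literal.eval σ) = true <;>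
      simp [h1, h2]

/-- A degree-`≤ d` refutation of `φ` can download the translation of a clause with at most `d`
literals. [Krajíček 2019, §6.2] [folklore] -/
theorem derivableInDegree_ofClause {φ : CNF ℕ} {C : Clause ℕ} {d : ℕ} (hC : C ∈ φ)
    (hlen : C.length ≤ d) : DerivableInDegree (ofCNF K φ) d (ofClause K C) :=
  .hyp (ofClause_mem_ofCNF hC) (by rw [totalDegree_ofClause]; exact hlen)

end Literature.Computability.MetaComplexity.PC
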